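import Summits.QuantumFields.BalabanUV.Beta.GAN24.T2RecChargeLedger
import Summits.QuantumFields.BalabanUV.Beta.GAN24.T2UndressedCombChargeStep
import Summits.QuantumFields.BalabanUV.Beta.GAN24.ThreeFaceRecClosed
import Summits.QuantumFields.BalabanUV.Beta.GAN24.RelSourceHalfCharge

/-!
# `BalabanUV.Beta.GAN24.RowCChargeForms` — binder row G-an2-4 ∕ (CONV-C), W-slot CT-W ∕ EXIT (α-0): **THE THREE FACES OF THE CONSERVATION ROW (C) ARE ONE ROW AT
# THE PIN** — «(C) of record» (R-HYB′: the B-frame sources `σ_l := T̃_{l+1} − 𝒜^B_l T̃_l` are bond-symmetrised ff zero-mode-free, the input of the (α-END)'s `hC` via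
# `RelSourceHalfCharge`) ⟺ «the dressed comb tower CONSERVES its bond-symmetrised ff charge, `zmodeSym_Lc (T̃_n) = zmodeSym_Lc (T̃_0)`» ⟺ «(C)sym» (route WC-TL's letter
# `zmodeSym_Lc (T̃_i) = zmodeSym_Lc (T_i)`, `T_i` the undressed-kernel comb reference tower — the `hC` of `ThreeFaceRecClosed.exists_allScalesSeq_JsRowD1Pin_of_C_QD`)
# (G-an2-4 FORMAL swarm → CRUX TEAM (2), leaf-01 lineage `b2b-balaban-gan24-formalise-leaf-01`, gen 73; journal INTENT [LEAF01-G73-INTENT1])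

NOT IN PRINT; OUR BOOKKEEPING ([folklore] compositions BY NAME: gan24-p2 g36's criterion `T2RecChargeStep.zfreeSym_sourceB_iff` and pin factor
`T2RecChargeLedger.charge_factor_eq_one_of_pinEq`, leaf-04 g59's reference recursion `T2UndressedCombChargeStep.zmode_succ_eq`, leaf-04 g62's F2a-comb
`ThreeFaceRecClosed.hZ_comb`, p2's member-`0` closed form `T2RecChargeStep.zmode_member_zero`, this lineage's g72 bridge `RelSourceHalfCharge.zsym_relSource_half`;
0 `def`, 0 cited facts, 0 `def … : Prop`, 0 sorry).  HONEST FRAMING (cell contract, verbatim): «discharging `BetaPertH` makes Bałaban's UV stability UNCONDITIONAL — a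
real constructive-QFT result; it is NOT the continuum limit and NOT the Clay problem.»  HONEST DEPENDENCY (verbatim): «continuum YM on T⁴ ⇐ BetaPertH ∧ nine spine
estimates (0/9 proved); BetaPertH ⇐ (D1) ∧ (D4) ∧ CAP+tail; G-an2-4 gates asym, D1 and NE2/3/4.»

NOTATION (docstrings only).  `T̃_j := unitS₂_j (T2RecAt d Lc (toSite r) cE cVH cΛ cE₂ cB Tc vh₂S (mixFFAt (toSite r) Lc) j)` (an2's DRESSED comb tower), `T_j := unitS₂_j
(T2RecOf d Lc (KInvStep Lc ·) (SpureRecAt d Lc (toSite r) cE cVH cΛ) (M1At d Lc (toSite r) cΛ) cE₂ cB Tc vh₂S (mixFFAt (toSite r) Lc) j)` (the undressed-kernel comb REFERENCE tower),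
`𝒜^B_j := lin4 (cE₂·Lc^{2(d+1)}) (unitK_j (KInvStep Lc j)) Lc`, `σ_j := T̃_{j+1} − 𝒜^B_j T̃_j` (p2 g36's B-frame source; = the R-HYB′ relative source `b′_j` of the (α-END)),
`b_j` := the reference tower's `T`-free source, `zmodeSym_Lc (X)(κ,κ′;κ₁,κ₂) := zmode Lc X κ κ′ (inl κ₁) (inl κ₂) + zmode Lc X κ′ κ (inl κ₁) (inl κ₂)`; the PIN enters ONLY as
the displayed `hpinEq : cE₂ = Lc^{d+5}` (= the D1 literal's `cE₂ = Lc⁸` at `d = 3`).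
WHAT (in-block root `r ∈ box (d+1) Lc`, `1 ≤ Lc`, all colour constants symbolic, an1-type border rows `hBff hBmm hB hBt` displayed):
* §1 (generic `d`) **`zsymMember_succ_eq_iff_rowC`** — per level: (C)_l of record ⟺ `zmodeSym_Lc (T̃_{l+1}) = zmodeSym_Lc (T̃_l)`; **`zsymMember_eq_zero_level_of_rowC`** ∕
  **`rowC_of_zsymMember_eq_zero_level`** ∕ **`rowC_iff_zsymMember_conserved`** — (C) at every level ⟺ the tower's symmetrised charge is its level-`0` value at every level;
  **`zsymMember_eq_wilson_of_rowC`** — that value in p2's closed form `cE₂·Lc^{d+1}·(Z₄(Tc)(κκ′) + Z₄(Tc)(κ′κ))`.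
* §2 **`zsymMemberB_succ_eq_of_F2a`** ∕ **`zsymMemberB_eq_zero_level_of_F2a`** (generic `d`, F2a-comb DISPLAYED) and **`zsymMemberB_eq_zero_level_three`** (`d = 3`, `3 ≤ Lc`,
  F2a-comb DISCHARGED by `ThreeFaceRecClosed.hZ_comb`): THE REFERENCE TOWER CONSERVES ITS SYMMETRISED ff CHARGE at the pin.
* §3 (`d = 3`, `3 ≤ Lc`, pin `cE₂ = Lc⁸`) **`rowC_iff_CSym_three`** — (C) OF RECORD ⟺ (C)sym (the `hC` binder of `ThreeFaceRecClosed.exists_allScalesSeq_JsRowD1Pin_of_C_QD`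
  at generic colour constants, VERBATIM); **`hC_halfMember_of_CSym_three`** — the (α-END)'s displayed `hC` for the `ε`-member (`T2ShapeEvenEndRows` ∕ `T2DriftEvenEndRows`,
  every `ε`) ⟸ (C)sym.
READING (docstring level, not asserted): after this file the (α-0) chain's open charge row and route WC-TL's (C)sym are ONE letter by name; its per-level content is p2's
balance `zmodeSym (b̃_l) + 2λ̂·Lc⁴·fourFaceSym_Lc (T̃_l) = zmodeSym_Lc (T̃_l)` (`T2RecChargeStepFourFace.zmode_succ_eq_fourFace` at `N = Lc` and the pin, rearranged), whose
left summand leaf-04 g66's `DressedSourceZeroModeLevelZero` computes at `l = 0`.  Asserts NO value of any charge of Bałaban's tables beyond p2's member-`0` closed form;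
discharges NOTHING of (C) ∕ (C)sym ∕ (Q-L) ∕ (Q-D) ∕ (Q-D-rate) ∕ `hcell` ∕ «T2Shape» ∕ «T2Drift» ∕ (hW, hWall); (β) of record untouched; NEVER «G-an2-4 closed» as (CONV-C);
NOT D1, NOT `BetaPertH`, NOT continuum, NOT Clay.  2026-08-23; no existing file touched.
-/

noncomputable section

open Finset
open scoped BigOperators
open Literature.MathematicalPhysics.QuantumFieldTheory
open Literature.MathematicalPhysics.QuantumFieldTheory.Balaban1983to89
open Literature.MathematicalPhysics.QuantumFieldTheory.Balaban1983to89.Beta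
open ExpKernelCalculus (MKer shiftK)
open OneStepResolventKernel (Fib)
open OneStepKernelFamily (KInvStep)
open AffineAveraging (box toSite)
open BalabanCompositeJets (LocStencil₂)
open AveragingMixedJetTables (mixFFAt)
open SecondOrderResponse (W2SymOfK)
open BalabanStepJetsSucc (mmRead)
open BalabanStepW2 (K3OfK M2Of)
open WilsonBiStencil (wilsonW₂)
open Summit.QuantumFields.BalabanUV.Beta.TameKernelCalculus (trK)
open Summit.QuantumFields.BalabanUV.Beta.BorderedHessian (sgnK)
open Summit.QuantumFields.BalabanUV.Beta.HessKerDressedUnits (unitK unitS)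
open Summit.QuantumFields.BalabanUV.Beta.SecondOrderUnits (unitM unitS₂ unitM₂)
open Summit.QuantumFields.BalabanUV.Beta.AxialDressingRooted (coDressKBmAt)
open Summit.QuantumFields.BalabanUV.Beta.SpineRooted (T2RecOf T2RecAt SpureRecAt M1At T2RecAt_zero_level T2RecOf_zero_level)
open Summit.QuantumFields.BalabanUV.Beta.GAN24.CombesThomas (sfStep smStep)
open Summit.QuantumFields.BalabanUV.Beta.GAN24.T2RecursionAffine (lin4)
open Summit.QuantumFields.BalabanUV.Beta.GAN24.BiStencilZeroMode (Tab zmode)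
open Summit.QuantumFields.BalabanUV.Beta.GAN24.T2RecChargeStep (zfreeSym_sourceB_iff zmode_member_zero)
open Summit.QuantumFields.BalabanUV.Beta.GAN24.T2RecChargeLedger (charge_factor_eq_one_of_pinEq)
open Summit.QuantumFields.BalabanUV.Beta.GAN24.ThreeFaceRecClosed (hZ_comb)
open Summit.QuantumFields.BalabanUV.Beta.GAN24.RelSourceHalfCharge (zsym_relSource_half)

namespace Summit.QuantumFields.BalabanUV.Beta.GAN24.RowCChargeForms

variable {d : ℕ} {Lc : ℕ} [NeZero Lc] {r : Fin (d + 1) → ℕ}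

/-! ## §0 Plumbing: the pointwise difference of two tables read inside `zmode` -/

/-- [folklore] The `Pi` difference of two bi-stencil tables is their pointwise difference (`rfl`; lets p2's lambda-form criterion be read in the (α-END)'s
`Pi`-difference spelling of the B-frame source). -/
theorem zmode_pi_sub (N : ℕ) (A B : Tab d) (κ κ' : Fin (d + 1)) (a b : Fib d) :
    zmode N (A - B) κ κ' a b = zmode N (fun κ u κ' u' => A κ u κ' u' - B κ u κ' u') κ κ' a b := rfl

/-! ## §1 (C) of record, per level, IS one-step conservation of the symmetrised charge (generic `d`, pin `cE₂ = Lc^{d+5}`) -/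

/-- NOT IN PRINT; OUR BOOKKEEPING.  **(C)_l OF RECORD ⟺ ONE-STEP CONSERVATION AT LEVEL `l`**: at the pin `cE₂ = Lc^{d+5}` the B-frame source
`σ_l = T̃_{l+1} − 𝒜^B_l T̃_l` is bond-symmetrised ff zero-mode-free at `(κ,κ′;κ₁,κ₂)` IFF `zmodeSym_Lc (T̃_{l+1}) = zmodeSym_Lc (T̃_l)` there — p2 g36's criterion
`zfreeSym_sourceB_iff` at `N := Lc` with the charge factor `Lc^{d+1}·(c·((Lc^{d+2})⁻¹)^4) = 1` (`charge_factor_eq_one_of_pinEq`). -/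
theorem zsymMember_succ_eq_iff_rowC (hLc : 1 ≤ Lc) (hr : r ∈ box (d + 1) Lc) (cE cVH cΛ cE₂ cB : ℝ) (Tc : Fin 4 → Fin 4 → Fin 4 → Fin 4 → ℝ)
    {vh₂S : Tab d} (hB : ∃ C δ : ℝ, 0 < δ ∧ LocStencil₂ vh₂S C δ)
    (hBt : ∀ (κ : Fin (d + 1)) (u : Fin (d + 1) → ℤ) (κ' : Fin (d + 1)) (u' t : Fin (d + 1) → ℤ),
      vh₂S κ (u + (Lc : ℤ) • t) κ' (u' + (Lc : ℤ) • t) = shiftK (-((Lc : ℤ) • t)) (vh₂S κ u κ' u'))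
    (hpinEq : cE₂ = (Lc : ℝ) ^ (d + 5)) (l : ℕ) (κ κ' κ₁ κ₂ : Fin (d + 1)) :
    (zmode Lc ((unitS₂ (sfStep Lc (l + 1)) (smStep d Lc (l + 1)) (T2RecAt d Lc (toSite r) cE cVH cΛ cE₂ cB Tc vh₂S (mixFFAt (toSite r) Lc) (l + 1)))
            - lin4 (cE₂ * (Lc : ℝ) ^ (2 * (d + 1))) (unitK (sfStep Lc l) (smStep d Lc l) (KInvStep (d := d) Lc l)) Lc
              (unitS₂ (sfStep Lc l) (smStep d Lc l) (T2RecAt d Lc (toSite r) cE cVH cΛ cE₂ cB Tc vh₂S (mixFFAt (toSite r) Lc) l))) κ κ' (Sum.inl κ₁) (Sum.inl κ₂)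
        + zmode Lc ((unitS₂ (sfStep Lc (l + 1)) (smStep d Lc (l + 1)) (T2RecAt d Lc (toSite r) cE cVH cΛ cE₂ cB Tc vh₂S (mixFFAt (toSite r) Lc) (l + 1)))
            - lin4 (cE₂ * (Lc : ℝ) ^ (2 * (d + 1))) (unitK (sfStep Lc l) (smStep d Lc l) (KInvStep (d := d) Lc l)) Lc
              (unitS₂ (sfStep Lc l) (smStep d Lc l) (T2RecAt d Lc (toSite r) cE cVH cΛ cE₂ cB Tc vh₂S (mixFFAt (toSite r) Lc) l))) κ' κ (Sum.inl κ₁) (Sum.inl κ₂) = 0)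
      ↔ zmode Lc (unitS₂ (sfStep Lc (l + 1)) (smStep d Lc (l + 1)) (T2RecAt d Lc (toSite r) cE cVH cΛ cE₂ cB Tc vh₂S (mixFFAt (toSite r) Lc) (l + 1))) κ κ' (Sum.inl κ₁) (Sum.inl κ₂)
        + zmode Lc (unitS₂ (sfStep Lc (l + 1)) (smStep d Lc (l + 1)) (T2RecAt d Lc (toSite r) cE cVH cΛ cE₂ cB Tc vh₂S (mixFFAt (toSite r) Lc) (l + 1))) κ' κ (Sum.inl κ₁) (Sum.inl κ₂)
          = zmode Lc (unitS₂ (sfStep Lc l) (smStep d Lc l) (T2RecAt d Lc (toSite r) cE cVH cΛ cE₂ cB Tc vh₂S (mixFFAt (toSite r) Lc) l)) κ κ' (Sum.inl κ₁) (Sum.inl κ₂)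
        + zmode Lc (unitS₂ (sfStep Lc l) (smStep d Lc l) (T2RecAt d Lc (toSite r) cE cVH cΛ cE₂ cB Tc vh₂S (mixFFAt (toSite r) Lc) l)) κ' κ (Sum.inl κ₁) (Sum.inl κ₂) := by
  have h := zfreeSym_sourceB_iff hLc hr cE cVH cΛ cE₂ cB Tc hB hBt Lc l κ κ' κ₁ κ₂
  rw [charge_factor_eq_one_of_pinEq (d := d) (Lc := Lc) hpinEq, one_mul] at h
  rw [zmode_pi_sub, zmode_pi_sub]
  exact h

/-- NOT IN PRINT; OUR BOOKKEEPING.  **(C) OF RECORD AT EVERY LEVEL ⟹ THE DRESSED COMB TOWER's SYMMETRISED ff CHARGE IS ITS LEVEL-`0` VALUE AT EVERY LEVEL**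
(induction on the level with §1's one-step form). -/
theorem zsymMember_eq_zero_level_of_rowC (hLc : 1 ≤ Lc) (hr : r ∈ box (d + 1) Lc) (cE cVH cΛ cE₂ cB : ℝ) (Tc : Fin 4 → Fin 4 → Fin 4 → Fin 4 → ℝ)
    {vh₂S : Tab d} (hB : ∃ C δ : ℝ, 0 < δ ∧ LocStencil₂ vh₂S C δ)
    (hBt : ∀ (κ : Fin (d + 1)) (u : Fin (d + 1) → ℤ) (κ' : Fin (d + 1)) (u' t : Fin (d + 1) → ℤ),
      vh₂S κ (u + (Lc : ℤ) • t) κ' (u' + (Lc : ℤ) • t) = shiftK (-((Lc : ℤ) • t)) (vh₂S κ u κ' u'))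
    (hpinEq : cE₂ = (Lc : ℝ) ^ (d + 5))
    (hC : ∀ (l : ℕ) (κ κ' κ₁ κ₂ : Fin (d + 1)),
      zmode Lc ((unitS₂ (sfStep Lc (l + 1)) (smStep d Lc (l + 1)) (T2RecAt d Lc (toSite r) cE cVH cΛ cE₂ cB Tc vh₂S (mixFFAt (toSite r) Lc) (l + 1)))
            - lin4 (cE₂ * (Lc : ℝ) ^ (2 * (d + 1))) (unitK (sfStep Lc l) (smStep d Lc l) (KInvStep (d := d) Lc l)) Lc
              (unitS₂ (sfStep Lc l) (smStep d Lc l) (T2RecAt d Lc (toSite r) cE cVH cΛ cE₂ cB Tc vh₂S (mixFFAt (toSite r) Lc) l))) κ κ' (Sum.inl κ₁) (Sum.inl κ₂)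
        + zmode Lc ((unitS₂ (sfStep Lc (l + 1)) (smStep d Lc (l + 1)) (T2RecAt d Lc (toSite r) cE cVH cΛ cE₂ cB Tc vh₂S (mixFFAt (toSite r) Lc) (l + 1)))
            - lin4 (cE₂ * (Lc : ℝ) ^ (2 * (d + 1))) (unitK (sfStep Lc l) (smStep d Lc l) (KInvStep (d := d) Lc l)) Lc
              (unitS₂ (sfStep Lc l) (smStep d Lc l) (T2RecAt d Lc (toSite r) cE cVH cΛ cE₂ cB Tc vh₂S (mixFFAt (toSite r) Lc) l))) κ' κ (Sum.inl κ₁) (Sum.inl κ₂) = 0)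
    (n : ℕ) (κ κ' κ₁ κ₂ : Fin (d + 1)) :
    zmode Lc (unitS₂ (sfStep Lc n) (smStep d Lc n) (T2RecAt d Lc (toSite r) cE cVH cΛ cE₂ cB Tc vh₂S (mixFFAt (toSite r) Lc) n)) κ κ' (Sum.inl κ₁) (Sum.inl κ₂)
        + zmode Lc (unitS₂ (sfStep Lc n) (smStep d Lc n) (T2RecAt d Lc (toSite r) cE cVH cΛ cE₂ cB Tc vh₂S (mixFFAt (toSite r) Lc) n)) κ' κ (Sum.inl κ₁) (Sum.inl κ₂)
      = zmode Lc (unitS₂ (sfStep Lc 0) (smStep d Lc 0) (T2RecAt d Lc (toSite r) cE cVH cΛ cE₂ cB Tc vh₂S (mixFFAt (toSite r) Lc) 0)) κ κ' (Sum.inl κ₁) (Sum.inl κ₂)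
        + zmode Lc (unitS₂ (sfStep Lc 0) (smStep d Lc 0) (T2RecAt d Lc (toSite r) cE cVH cΛ cE₂ cB Tc vh₂S (mixFFAt (toSite r) Lc) 0)) κ' κ (Sum.inl κ₁) (Sum.inl κ₂) := by
  induction n with
  | zero => rfl
  | succ n ih =>
    rw [← ih]
    exact (zsymMember_succ_eq_iff_rowC hLc hr cE cVH cΛ cE₂ cB Tc hB hBt hpinEq n κ κ' κ₁ κ₂).1 (hC n κ κ' κ₁ κ₂)

/-- NOT IN PRINT; OUR BOOKKEEPING.  **THE CONVERSE**: if the dressed comb tower's symmetrised ff charge is its level-`0` value at every level, (C) of record holds at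
every level (§1's one-step form, right to left). -/
theorem rowC_of_zsymMember_eq_zero_level (hLc : 1 ≤ Lc) (hr : r ∈ box (d + 1) Lc) (cE cVH cΛ cE₂ cB : ℝ) (Tc : Fin 4 → Fin 4 → Fin 4 → Fin 4 → ℝ)
    {vh₂S : Tab d} (hB : ∃ C δ : ℝ, 0 < δ ∧ LocStencil₂ vh₂S C δ)
    (hBt : ∀ (κ : Fin (d + 1)) (u : Fin (d + 1) → ℤ) (κ' : Fin (d + 1)) (u' t : Fin (d + 1) → ℤ),
      vh₂S κ (u + (Lc : ℤ) • t) κ' (u' + (Lc : ℤ) • t) = shiftK (-((Lc : ℤ) • t)) (vh₂S κ u κ' u'))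
    (hpinEq : cE₂ = (Lc : ℝ) ^ (d + 5))
    (hZ : ∀ (n : ℕ) (κ κ' κ₁ κ₂ : Fin (d + 1)),
      zmode Lc (unitS₂ (sfStep Lc n) (smStep d Lc n) (T2RecAt d Lc (toSite r) cE cVH cΛ cE₂ cB Tc vh₂S (mixFFAt (toSite r) Lc) n)) κ κ' (Sum.inl κ₁) (Sum.inl κ₂)
        + zmode Lc (unitS₂ (sfStep Lc n) (smStep d Lc n) (T2RecAt d Lc (toSite r) cE cVH cΛ cE₂ cB Tc vh₂S (mixFFAt (toSite r) Lc) n)) κ' κ (Sum.inl κ₁) (Sum.inl κ₂)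
        = zmode Lc (unitS₂ (sfStep Lc 0) (smStep d Lc 0) (T2RecAt d Lc (toSite r) cE cVH cΛ cE₂ cB Tc vh₂S (mixFFAt (toSite r) Lc) 0)) κ κ' (Sum.inl κ₁) (Sum.inl κ₂)
        + zmode Lc (unitS₂ (sfStep Lc 0) (smStep d Lc 0) (T2RecAt d Lc (toSite r) cE cVH cΛ cE₂ cB Tc vh₂S (mixFFAt (toSite r) Lc) 0)) κ' κ (Sum.inl κ₁) (Sum.inl κ₂))
    (l : ℕ) (κ κ' κ₁ κ₂ : Fin (d + 1)) :
    zmode Lc ((unitS₂ (sfStep Lc (l + 1)) (smStep d Lc (l + 1)) (T2RecAt d Lc (toSite r) cE cVH cΛ cE₂ cB Tc vh₂S (mixFFAt (toSite r) Lc) (l + 1)))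
            - lin4 (cE₂ * (Lc : ℝ) ^ (2 * (d + 1))) (unitK (sfStep Lc l) (smStep d Lc l) (KInvStep (d := d) Lc l)) Lc
              (unitS₂ (sfStep Lc l) (smStep d Lc l) (T2RecAt d Lc (toSite r) cE cVH cΛ cE₂ cB Tc vh₂S (mixFFAt (toSite r) Lc) l))) κ κ' (Sum.inl κ₁) (Sum.inl κ₂)
        + zmode Lc ((unitS₂ (sfStep Lc (l + 1)) (smStep d Lc (l + 1)) (T2RecAt d Lc (toSite r) cE cVH cΛ cE₂ cB Tc vh₂S (mixFFAt (toSite r) Lc) (l + 1)))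
            - lin4 (cE₂ * (Lc : ℝ) ^ (2 * (d + 1))) (unitK (sfStep Lc l) (smStep d Lc l) (KInvStep (d := d) Lc l)) Lc
              (unitS₂ (sfStep Lc l) (smStep d Lc l) (T2RecAt d Lc (toSite r) cE cVH cΛ cE₂ cB Tc vh₂S (mixFFAt (toSite r) Lc) l))) κ' κ (Sum.inl κ₁) (Sum.inl κ₂) = 0 := by
  refine (zsymMember_succ_eq_iff_rowC hLc hr cE cVH cΛ cE₂ cB Tc hB hBt hpinEq l κ κ' κ₁ κ₂).2 ?_
  rw [hZ (l + 1) κ κ' κ₁ κ₂, hZ l κ κ' κ₁ κ₂]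

/-- NOT IN PRINT; OUR BOOKKEEPING.  **(C) OF RECORD ⟺ CONSERVATION OF THE SYMMETRISED ff CHARGE ALONG THE DRESSED COMB TOWER** (at the pin; the two theorems
above packaged) — L10's sentence «conservation of the symmetrised charge along the dressed comb tower at the exact pin» as an `Iff` in the tree. -/
theorem rowC_iff_zsymMember_conserved (hLc : 1 ≤ Lc) (hr : r ∈ box (d + 1) Lc) (cE cVH cΛ cE₂ cB : ℝ) (Tc : Fin 4 → Fin 4 → Fin 4 → Fin 4 → ℝ)
    {vh₂S : Tab d} (hB : ∃ C δ : ℝ, 0 < δ ∧ LocStencil₂ vh₂S C δ)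
    (hBt : ∀ (κ : Fin (d + 1)) (u : Fin (d + 1) → ℤ) (κ' : Fin (d + 1)) (u' t : Fin (d + 1) → ℤ),
      vh₂S κ (u + (Lc : ℤ) • t) κ' (u' + (Lc : ℤ) • t) = shiftK (-((Lc : ℤ) • t)) (vh₂S κ u κ' u'))
    (hpinEq : cE₂ = (Lc : ℝ) ^ (d + 5)) :
    (∀ (l : ℕ) (κ κ' κ₁ κ₂ : Fin (d + 1)),
      zmode Lc ((unitS₂ (sfStep Lc (l + 1)) (smStep d Lc (l + 1)) (T2RecAt d Lc (toSite r) cE cVH cΛ cE₂ cB Tc vh₂S (mixFFAt (toSite r) Lc) (l + 1)))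
            - lin4 (cE₂ * (Lc : ℝ) ^ (2 * (d + 1))) (unitK (sfStep Lc l) (smStep d Lc l) (KInvStep (d := d) Lc l)) Lc
              (unitS₂ (sfStep Lc l) (smStep d Lc l) (T2RecAt d Lc (toSite r) cE cVH cΛ cE₂ cB Tc vh₂S (mixFFAt (toSite r) Lc) l))) κ κ' (Sum.inl κ₁) (Sum.inl κ₂)
        + zmode Lc ((unitS₂ (sfStep Lc (l + 1)) (smStep d Lc (l + 1)) (T2RecAt d Lc (toSite r) cE cVH cΛ cE₂ cB Tc vh₂S (mixFFAt (toSite r) Lc) (l + 1)))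
            - lin4 (cE₂ * (Lc : ℝ) ^ (2 * (d + 1))) (unitK (sfStep Lc l) (smStep d Lc l) (KInvStep (d := d) Lc l)) Lc
              (unitS₂ (sfStep Lc l) (smStep d Lc l) (T2RecAt d Lc (toSite r) cE cVH cΛ cE₂ cB Tc vh₂S (mixFFAt (toSite r) Lc) l))) κ' κ (Sum.inl κ₁) (Sum.inl κ₂) = 0)
      ↔ ∀ (n : ℕ) (κ κ' κ₁ κ₂ : Fin (d + 1)),
        zmode Lc (unitS₂ (sfStep Lc n) (smStep d Lc n) (T2RecAt d Lc (toSite r) cE cVH cΛ cE₂ cB Tc vh₂S (mixFFAt (toSite r) Lc) n)) κ κ' (Sum.inl κ₁) (Sum.inl κ₂)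
        + zmode Lc (unitS₂ (sfStep Lc n) (smStep d Lc n) (T2RecAt d Lc (toSite r) cE cVH cΛ cE₂ cB Tc vh₂S (mixFFAt (toSite r) Lc) n)) κ' κ (Sum.inl κ₁) (Sum.inl κ₂)
          = zmode Lc (unitS₂ (sfStep Lc 0) (smStep d Lc 0) (T2RecAt d Lc (toSite r) cE cVH cΛ cE₂ cB Tc vh₂S (mixFFAt (toSite r) Lc) 0)) κ κ' (Sum.inl κ₁) (Sum.inl κ₂)
        + zmode Lc (unitS₂ (sfStep Lc 0) (smStep d Lc 0) (T2RecAt d Lc (toSite r) cE cVH cΛ cE₂ cB Tc vh₂S (mixFFAt (toSite r) Lc) 0)) κ' κ (Sum.inl κ₁) (Sum.inl κ₂) :=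
  ⟨fun hC => zsymMember_eq_zero_level_of_rowC hLc hr cE cVH cΛ cE₂ cB Tc hB hBt hpinEq hC,
    fun hZ => rowC_of_zsymMember_eq_zero_level hLc hr cE cVH cΛ cE₂ cB Tc hB hBt hpinEq hZ⟩

/-- NOT IN PRINT; OUR BOOKKEEPING.  **UNDER (C) OF RECORD THE SYMMETRISED ff CHARGE OF EVERY MEMBER IS THE WILSON TABLE's**, in p2 g36's closed form
(`T2RecChargeStep.zmode_member_zero`: `zmode N T̃₀ (μ,ν;α,β) = cE₂·N^{d+1}·Z₄(Tc)(μ,ν;α,β)`, `Z₄(Tc) := Σ'_{u′xz} wilsonW₂ d Tc μ 0 ν u′ x z (inl α) (inl β)`; the border's ff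
block is `0` by `hBff`). -/
theorem zsymMember_eq_wilson_of_rowC (hLc : 1 ≤ Lc) (hr : r ∈ box (d + 1) Lc) (cE cVH cΛ cE₂ cB : ℝ) (Tc : Fin 4 → Fin 4 → Fin 4 → Fin 4 → ℝ)
    {vh₂S : Tab d} (hBff : ∀ κ u κ' u' x z (α β : Fin (d + 1)), vh₂S κ u κ' u' x z (Sum.inl α) (Sum.inl β) = 0) (hB : ∃ C δ : ℝ, 0 < δ ∧ LocStencil₂ vh₂S C δ)
    (hBt : ∀ (κ : Fin (d + 1)) (u : Fin (d + 1) → ℤ) (κ' : Fin (d + 1)) (u' t : Fin (d + 1) → ℤ),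
      vh₂S κ (u + (Lc : ℤ) • t) κ' (u' + (Lc : ℤ) • t) = shiftK (-((Lc : ℤ) • t)) (vh₂S κ u κ' u'))
    (hpinEq : cE₂ = (Lc : ℝ) ^ (d + 5))
    (hC : ∀ (l : ℕ) (κ κ' κ₁ κ₂ : Fin (d + 1)),
      zmode Lc ((unitS₂ (sfStep Lc (l + 1)) (smStep d Lc (l + 1)) (T2RecAt d Lc (toSite r) cE cVH cΛ cE₂ cB Tc vh₂S (mixFFAt (toSite r) Lc) (l + 1)))
            - lin4 (cE₂ * (Lc : ℝ) ^ (2 * (d + 1))) (unitK (sfStep Lc l) (smStep d Lc l) (KInvStep (d := d) Lc l)) Lc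
              (unitS₂ (sfStep Lc l) (smStep d Lc l) (T2RecAt d Lc (toSite r) cE cVH cΛ cE₂ cB Tc vh₂S (mixFFAt (toSite r) Lc) l))) κ κ' (Sum.inl κ₁) (Sum.inl κ₂)
        + zmode Lc ((unitS₂ (sfStep Lc (l + 1)) (smStep d Lc (l + 1)) (T2RecAt d Lc (toSite r) cE cVH cΛ cE₂ cB Tc vh₂S (mixFFAt (toSite r) Lc) (l + 1)))
            - lin4 (cE₂ * (Lc : ℝ) ^ (2 * (d + 1))) (unitK (sfStep Lc l) (smStep d Lc l) (KInvStep (d := d) Lc l)) Lc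
              (unitS₂ (sfStep Lc l) (smStep d Lc l) (T2RecAt d Lc (toSite r) cE cVH cΛ cE₂ cB Tc vh₂S (mixFFAt (toSite r) Lc) l))) κ' κ (Sum.inl κ₁) (Sum.inl κ₂) = 0)
    (n : ℕ) (κ κ' κ₁ κ₂ : Fin (d + 1)) :
    zmode Lc (unitS₂ (sfStep Lc n) (smStep d Lc n) (T2RecAt d Lc (toSite r) cE cVH cΛ cE₂ cB Tc vh₂S (mixFFAt (toSite r) Lc) n)) κ κ' (Sum.inl κ₁) (Sum.inl κ₂)
        + zmode Lc (unitS₂ (sfStep Lc n) (smStep d Lc n) (T2RecAt d Lc (toSite r) cE cVH cΛ cE₂ cB Tc vh₂S (mixFFAt (toSite r) Lc) n)) κ' κ (Sum.inl κ₁) (Sum.inl κ₂)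
      = cE₂ * (((Lc : ℝ) ^ (d + 1)) *
            ∑' u' : Fin (d + 1) → ℤ, ∑' x : Fin (d + 1) → ℤ, ∑' z : Fin (d + 1) → ℤ,
              wilsonW₂ d Tc κ 0 κ' u' x z (Sum.inl κ₁) (Sum.inl κ₂))
        + cE₂ * (((Lc : ℝ) ^ (d + 1)) *
            ∑' u' : Fin (d + 1) → ℤ, ∑' x : Fin (d + 1) → ℤ, ∑' z : Fin (d + 1) → ℤ,
              wilsonW₂ d Tc κ' 0 κ u' x z (Sum.inl κ₁) (Sum.inl κ₂)) := by
  rw [zsymMember_eq_zero_level_of_rowC hLc hr cE cVH cΛ cE₂ cB Tc hB hBt hpinEq hC n κ κ' κ₁ κ₂,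
    zmode_member_zero Lc cE cVH cΛ cE₂ cB Tc (toSite r) hBff κ κ' κ₁ κ₂, zmode_member_zero Lc cE cVH cΛ cE₂ cB Tc (toSite r) hBff κ' κ κ₁ κ₂]

/-! ## §2 The reference tower conserves its symmetrised ff charge at the pin -/

/-- NOT IN PRINT; OUR BOOKKEEPING.  **ONE STEP OF THE REFERENCE TOWER CONSERVES THE SYMMETRISED ff CHARGE** (generic `d`, pin `cE₂ = Lc^{d+5}`, F2a-comb — the
reference sources `b_i` bond-symmetrised zero-mode-free — DISPLAYED as `hZb`): leaf-04 g59's `T2UndressedCombChargeStep.zmode_succ_eq` at `N := Lc` for the two bond orders,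
summed; the undressed step multiplies the symmetrised charge by `Lc^{d+1}·(c·((Lc^{d+2})⁻¹)^4) = 1`. -/
theorem zsymMemberB_succ_eq_of_F2a (hLc : 1 ≤ Lc) (hr : r ∈ box (d + 1) Lc) (cE cVH cΛ cE₂ cB : ℝ) (Tc : Fin 4 → Fin 4 → Fin 4 → Fin 4 → ℝ)
    {vh₂S : Tab d} (hBff : ∀ κ u κ' u' x z (α β : Fin (d + 1)), vh₂S κ u κ' u' x z (Sum.inl α) (Sum.inl β) = 0)
    (hBmm : ∀ κ u κ' u' x z (μ ν : Fin (d + 1)), vh₂S κ u κ' u' x z (Sum.inr μ) (Sum.inr ν) = 0)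
    (hB : ∃ C δ : ℝ, 0 < δ ∧ LocStencil₂ vh₂S C δ)
    (hBt : ∀ (κ : Fin (d + 1)) (u : Fin (d + 1) → ℤ) (κ' : Fin (d + 1)) (u' t : Fin (d + 1) → ℤ),
      vh₂S κ (u + (Lc : ℤ) • t) κ' (u' + (Lc : ℤ) • t) = shiftK (-((Lc : ℤ) • t)) (vh₂S κ u κ' u'))
    (hpinEq : cE₂ = (Lc : ℝ) ^ (d + 5))
    (hZb : ∀ (i : ℕ) (κ κ' κ₁ κ₂ : Fin (d + 1)),
      zmode Lc (fun κ u κ' u' => (cE₂ * (Lc : ℝ) ^ (2 * (d + 1))) •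
              mmRead Lc (K3OfK (unitK (sfStep Lc i) (smStep d Lc i) (KInvStep (d := d) Lc i)) Lc
              (unitS (sfStep Lc i) (smStep d Lc i) (SpureRecAt d Lc (toSite r) cE cVH cΛ i)) (unitM (sfStep Lc i) (smStep d Lc i) (M1At d Lc (toSite r) cΛ i))
              (W2SymOfK (unitK (sfStep Lc i) (smStep d Lc i) (KInvStep (d := d) Lc i)) Lc
                (unitS (sfStep Lc i) (smStep d Lc i) (SpureRecAt d Lc (toSite r) cE cVH cΛ i)) (unitM (sfStep Lc i) (smStep d Lc i) (M1At d Lc (toSite r) cΛ i)) 0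
                (unitM₂ (sfStep Lc i) (smStep d Lc i) (M2Of d Lc (mixFFAt (toSite r) Lc) i))) κ u κ' u') + cB • vh₂S κ u κ' u') κ κ' (Sum.inl κ₁) (Sum.inl κ₂)
        + zmode Lc (fun κ u κ' u' => (cE₂ * (Lc : ℝ) ^ (2 * (d + 1))) •
              mmRead Lc (K3OfK (unitK (sfStep Lc i) (smStep d Lc i) (KInvStep (d := d) Lc i)) Lc
              (unitS (sfStep Lc i) (smStep d Lc i) (SpureRecAt d Lc (toSite r) cE cVH cΛ i)) (unitM (sfStep Lc i) (smStep d Lc i) (M1At d Lc (toSite r) cΛ i))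
              (W2SymOfK (unitK (sfStep Lc i) (smStep d Lc i) (KInvStep (d := d) Lc i)) Lc
                (unitS (sfStep Lc i) (smStep d Lc i) (SpureRecAt d Lc (toSite r) cE cVH cΛ i)) (unitM (sfStep Lc i) (smStep d Lc i) (M1At d Lc (toSite r) cΛ i)) 0
                (unitM₂ (sfStep Lc i) (smStep d Lc i) (M2Of d Lc (mixFFAt (toSite r) Lc) i))) κ u κ' u') + cB • vh₂S κ u κ' u') κ' κ (Sum.inl κ₁) (Sum.inl κ₂) = 0)
    (j : ℕ) (κ κ' κ₁ κ₂ : Fin (d + 1)) :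
    zmode Lc (unitS₂ (sfStep Lc (j + 1)) (smStep d Lc (j + 1)) (T2RecOf d Lc (fun j => KInvStep (d := d) Lc j) (SpureRecAt d Lc (toSite r) cE cVH cΛ) (M1At d Lc (toSite r) cΛ) cE₂ cB Tc vh₂S (mixFFAt (toSite r) Lc) (j + 1))) κ κ' (Sum.inl κ₁) (Sum.inl κ₂)
        + zmode Lc (unitS₂ (sfStep Lc (j + 1)) (smStep d Lc (j + 1)) (T2RecOf d Lc (fun j => KInvStep (d := d) Lc j) (SpureRecAt d Lc (toSite r) cE cVH cΛ) (M1At d Lc (toSite r) cΛ) cE₂ cB Tc vh₂S (mixFFAt (toSite r) Lc) (j + 1))) κ' κ (Sum.inl κ₁) (Sum.inl κ₂)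
      = zmode Lc (unitS₂ (sfStep Lc j) (smStep d Lc j) (T2RecOf d Lc (fun j => KInvStep (d := d) Lc j) (SpureRecAt d Lc (toSite r) cE cVH cΛ) (M1At d Lc (toSite r) cΛ) cE₂ cB Tc vh₂S (mixFFAt (toSite r) Lc) j)) κ κ' (Sum.inl κ₁) (Sum.inl κ₂)
        + zmode Lc (unitS₂ (sfStep Lc j) (smStep d Lc j) (T2RecOf d Lc (fun j => KInvStep (d := d) Lc j) (SpureRecAt d Lc (toSite r) cE cVH cΛ) (M1At d Lc (toSite r) cΛ) cE₂ cB Tc vh₂S (mixFFAt (toSite r) Lc) j)) κ' κ (Sum.inl κ₁) (Sum.inl κ₂) := by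
  have key := T2UndressedCombChargeStep.zmode_succ_eq hLc hr Lc cE cVH cΛ cE₂ cB Tc hBff hBmm hB hBt j κ κ' κ₁ κ₂
  have key' := T2UndressedCombChargeStep.zmode_succ_eq hLc hr Lc cE cVH cΛ cE₂ cB Tc hBff hBmm hB hBt j κ' κ κ₁ κ₂
  have hfac := charge_factor_eq_one_of_pinEq (d := d) (Lc := Lc) hpinEq
  linear_combination key + key' + hZb j κ κ' κ₁ κ₂
    + (zmode Lc (unitS₂ (sfStep Lc j) (smStep d Lc j) (T2RecOf d Lc (fun j => KInvStep (d := d) Lc j) (SpureRecAt d Lc (toSite r) cE cVH cΛ) (M1At d Lc (toSite r) cΛ) cE₂ cB Tc vh₂S (mixFFAt (toSite r) Lc) j)) κ κ' (Sum.inl κ₁) (Sum.inl κ₂)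
        + zmode Lc (unitS₂ (sfStep Lc j) (smStep d Lc j) (T2RecOf d Lc (fun j => KInvStep (d := d) Lc j) (SpureRecAt d Lc (toSite r) cE cVH cΛ) (M1At d Lc (toSite r) cΛ) cE₂ cB Tc vh₂S (mixFFAt (toSite r) Lc) j)) κ' κ (Sum.inl κ₁) (Sum.inl κ₂)) * hfac

/-- NOT IN PRINT; OUR BOOKKEEPING.  **THE REFERENCE TOWER's SYMMETRISED ff CHARGE IS ITS LEVEL-`0` VALUE AT EVERY LEVEL** (generic `d`, pin, F2a-comb displayed;
induction on the level). -/
theorem zsymMemberB_eq_zero_level_of_F2a (hLc : 1 ≤ Lc) (hr : r ∈ box (d + 1) Lc) (cE cVH cΛ cE₂ cB : ℝ) (Tc : Fin 4 → Fin 4 → Fin 4 → Fin 4 → ℝ)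
    {vh₂S : Tab d} (hBff : ∀ κ u κ' u' x z (α β : Fin (d + 1)), vh₂S κ u κ' u' x z (Sum.inl α) (Sum.inl β) = 0)
    (hBmm : ∀ κ u κ' u' x z (μ ν : Fin (d + 1)), vh₂S κ u κ' u' x z (Sum.inr μ) (Sum.inr ν) = 0)
    (hB : ∃ C δ : ℝ, 0 < δ ∧ LocStencil₂ vh₂S C δ)
    (hBt : ∀ (κ : Fin (d + 1)) (u : Fin (d + 1) → ℤ) (κ' : Fin (d + 1)) (u' t : Fin (d + 1) → ℤ),
      vh₂S κ (u + (Lc : ℤ) • t) κ' (u' + (Lc : ℤ) • t) = shiftK (-((Lc : ℤ) • t)) (vh₂S κ u κ' u'))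
    (hpinEq : cE₂ = (Lc : ℝ) ^ (d + 5))
    (hZb : ∀ (i : ℕ) (κ κ' κ₁ κ₂ : Fin (d + 1)),
      zmode Lc (fun κ u κ' u' => (cE₂ * (Lc : ℝ) ^ (2 * (d + 1))) •
              mmRead Lc (K3OfK (unitK (sfStep Lc i) (smStep d Lc i) (KInvStep (d := d) Lc i)) Lc
              (unitS (sfStep Lc i) (smStep d Lc i) (SpureRecAt d Lc (toSite r) cE cVH cΛ i)) (unitM (sfStep Lc i) (smStep d Lc i) (M1At d Lc (toSite r) cΛ i))
              (W2SymOfK (unitK (sfStep Lc i) (smStep d Lc i) (KInvStep (d := d) Lc i)) Lc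
                (unitS (sfStep Lc i) (smStep d Lc i) (SpureRecAt d Lc (toSite r) cE cVH cΛ i)) (unitM (sfStep Lc i) (smStep d Lc i) (M1At d Lc (toSite r) cΛ i)) 0
                (unitM₂ (sfStep Lc i) (smStep d Lc i) (M2Of d Lc (mixFFAt (toSite r) Lc) i))) κ u κ' u') + cB • vh₂S κ u κ' u') κ κ' (Sum.inl κ₁) (Sum.inl κ₂)
        + zmode Lc (fun κ u κ' u' => (cE₂ * (Lc : ℝ) ^ (2 * (d + 1))) •
              mmRead Lc (K3OfK (unitK (sfStep Lc i) (smStep d Lc i) (KInvStep (d := d) Lc i)) Lc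
              (unitS (sfStep Lc i) (smStep d Lc i) (SpureRecAt d Lc (toSite r) cE cVH cΛ i)) (unitM (sfStep Lc i) (smStep d Lc i) (M1At d Lc (toSite r) cΛ i))
              (W2SymOfK (unitK (sfStep Lc i) (smStep d Lc i) (KInvStep (d := d) Lc i)) Lc
                (unitS (sfStep Lc i) (smStep d Lc i) (SpureRecAt d Lc (toSite r) cE cVH cΛ i)) (unitM (sfStep Lc i) (smStep d Lc i) (M1At d Lc (toSite r) cΛ i)) 0
                (unitM₂ (sfStep Lc i) (smStep d Lc i) (M2Of d Lc (mixFFAt (toSite r) Lc) i))) κ u κ' u') + cB • vh₂S κ u κ' u') κ' κ (Sum.inl κ₁) (Sum.inl κ₂) = 0)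
    (n : ℕ) (κ κ' κ₁ κ₂ : Fin (d + 1)) :
    zmode Lc (unitS₂ (sfStep Lc n) (smStep d Lc n) (T2RecOf d Lc (fun j => KInvStep (d := d) Lc j) (SpureRecAt d Lc (toSite r) cE cVH cΛ) (M1At d Lc (toSite r) cΛ) cE₂ cB Tc vh₂S (mixFFAt (toSite r) Lc) n)) κ κ' (Sum.inl κ₁) (Sum.inl κ₂)
        + zmode Lc (unitS₂ (sfStep Lc n) (smStep d Lc n) (T2RecOf d Lc (fun j => KInvStep (d := d) Lc j) (SpureRecAt d Lc (toSite r) cE cVH cΛ) (M1At d Lc (toSite r) cΛ) cE₂ cB Tc vh₂S (mixFFAt (toSite r) Lc) n)) κ' κ (Sum.inl κ₁) (Sum.inl κ₂)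
      = zmode Lc (unitS₂ (sfStep Lc 0) (smStep d Lc 0) (T2RecOf d Lc (fun j => KInvStep (d := d) Lc j) (SpureRecAt d Lc (toSite r) cE cVH cΛ) (M1At d Lc (toSite r) cΛ) cE₂ cB Tc vh₂S (mixFFAt (toSite r) Lc) 0)) κ κ' (Sum.inl κ₁) (Sum.inl κ₂)
        + zmode Lc (unitS₂ (sfStep Lc 0) (smStep d Lc 0) (T2RecOf d Lc (fun j => KInvStep (d := d) Lc j) (SpureRecAt d Lc (toSite r) cE cVH cΛ) (M1At d Lc (toSite r) cΛ) cE₂ cB Tc vh₂S (mixFFAt (toSite r) Lc) 0)) κ' κ (Sum.inl κ₁) (Sum.inl κ₂) := by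
  induction n with
  | zero => rfl
  | succ n ih =>
    rw [← ih]
    exact zsymMemberB_succ_eq_of_F2a hLc hr cE cVH cΛ cE₂ cB Tc hBff hBmm hB hBt hpinEq hZb n κ κ' κ₁ κ₂

/-- NOT IN PRINT; OUR BOOKKEEPING.  **AT `d = 3`, `3 ≤ Lc` AND THE PIN `cE₂ = Lc⁸` THE REFERENCE TOWER CONSERVES ITS SYMMETRISED ff CHARGE — HYPOTHESIS-FREE modulo
the displayed border rows**: F2a-comb is DISCHARGED at every level by leaf-04 g62's `ThreeFaceRecClosed.hZ_comb` («S3C-REC» every member ⟸ (W-face), a tree theorem). -/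
theorem zsymMemberB_eq_zero_level_three (hLc : 3 ≤ Lc) {r : Fin (3 + 1) → ℕ} (hr : r ∈ box (3 + 1) Lc) (cE cVH cΛ cE₂ cB : ℝ) (Tc : Fin 4 → Fin 4 → Fin 4 → Fin 4 → ℝ)
    {vh₂S : Tab 3} (hBff : ∀ κ u κ' u' x z (α β : Fin (3 + 1)), vh₂S κ u κ' u' x z (Sum.inl α) (Sum.inl β) = 0)
    (hBmm : ∀ κ u κ' u' x z (μ ν : Fin (3 + 1)), vh₂S κ u κ' u' x z (Sum.inr μ) (Sum.inr ν) = 0)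
    {CB δB : ℝ} (hB : LocStencil₂ vh₂S CB δB) (hδB : 0 < δB)
    (hBt : ∀ (κ : Fin (3 + 1)) (u : Fin (3 + 1) → ℤ) (κ' : Fin (3 + 1)) (u' t : Fin (3 + 1) → ℤ),
      vh₂S κ (u + (Lc : ℤ) • t) κ' (u' + (Lc : ℤ) • t) = shiftK (-((Lc : ℤ) • t)) (vh₂S κ u κ' u'))
    (hcE₂ : cE₂ = (Lc : ℝ) ^ 8) (n : ℕ) (κ κ' κ₁ κ₂ : Fin (3 + 1)) :
    zmode Lc (unitS₂ (sfStep Lc n) (smStep 3 Lc n) (T2RecOf 3 Lc (fun j => KInvStep (d := 3) Lc j) (SpureRecAt 3 Lc (toSite r) cE cVH cΛ) (M1At 3 Lc (toSite r) cΛ) cE₂ cB Tc vh₂S (mixFFAt (toSite r) Lc) n)) κ κ' (Sum.inl κ₁) (Sum.inl κ₂)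
        + zmode Lc (unitS₂ (sfStep Lc n) (smStep 3 Lc n) (T2RecOf 3 Lc (fun j => KInvStep (d := 3) Lc j) (SpureRecAt 3 Lc (toSite r) cE cVH cΛ) (M1At 3 Lc (toSite r) cΛ) cE₂ cB Tc vh₂S (mixFFAt (toSite r) Lc) n)) κ' κ (Sum.inl κ₁) (Sum.inl κ₂)
      = zmode Lc (unitS₂ (sfStep Lc 0) (smStep 3 Lc 0) (T2RecOf 3 Lc (fun j => KInvStep (d := 3) Lc j) (SpureRecAt 3 Lc (toSite r) cE cVH cΛ) (M1At 3 Lc (toSite r) cΛ) cE₂ cB Tc vh₂S (mixFFAt (toSite r) Lc) 0)) κ κ' (Sum.inl κ₁) (Sum.inl κ₂)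
        + zmode Lc (unitS₂ (sfStep Lc 0) (smStep 3 Lc 0) (T2RecOf 3 Lc (fun j => KInvStep (d := 3) Lc j) (SpureRecAt 3 Lc (toSite r) cE cVH cΛ) (M1At 3 Lc (toSite r) cΛ) cE₂ cB Tc vh₂S (mixFFAt (toSite r) Lc) 0)) κ' κ (Sum.inl κ₁) (Sum.inl κ₂) :=
  zsymMemberB_eq_zero_level_of_F2a (d := 3) (le_trans (by norm_num) hLc) hr cE cVH cΛ cE₂ cB Tc hBff hBmm ⟨CB, δB, hδB, hB⟩ hBt
    (hcE₂.trans (by norm_num)) (fun i => (hZ_comb hLc hr cE cVH cΛ cE₂ cB Tc hBff hBmm hB hδB hBt i).2) n κ κ' κ₁ κ₂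

/-! ## §3 (C) of record ⟺ (C)sym (`d = 3`, `3 ≤ Lc`, pin `cE₂ = Lc⁸`) -/

/-- [folklore] Member `0` of the dressed and of the reference comb tower is the SAME table (`cE₂ • wilsonW₂ d Tc + cB • vh₂S`; `T2RecAt_zero_level`,
`T2RecOf_zero_level`), hence so are their symmetrised ff charges (generic `d`, any constants, no hypothesis). -/
theorem zsymMember_zero_eq_zsymMemberB_zero (cE cVH cΛ cE₂ cB : ℝ) (Tc : Fin 4 → Fin 4 → Fin 4 → Fin 4 → ℝ) (vh₂S : Tab d) (κ κ' κ₁ κ₂ : Fin (d + 1)) :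
    zmode Lc (unitS₂ (sfStep Lc 0) (smStep d Lc 0) (T2RecAt d Lc (toSite r) cE cVH cΛ cE₂ cB Tc vh₂S (mixFFAt (toSite r) Lc) 0)) κ κ' (Sum.inl κ₁) (Sum.inl κ₂)
        + zmode Lc (unitS₂ (sfStep Lc 0) (smStep d Lc 0) (T2RecAt d Lc (toSite r) cE cVH cΛ cE₂ cB Tc vh₂S (mixFFAt (toSite r) Lc) 0)) κ' κ (Sum.inl κ₁) (Sum.inl κ₂)
      = zmode Lc (unitS₂ (sfStep Lc 0) (smStep d Lc 0) (T2RecOf d Lc (fun j => KInvStep (d := d) Lc j) (SpureRecAt d Lc (toSite r) cE cVH cΛ) (M1At d Lc (toSite r) cΛ) cE₂ cB Tc vh₂S (mixFFAt (toSite r) Lc) 0)) κ κ' (Sum.inl κ₁) (Sum.inl κ₂)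
        + zmode Lc (unitS₂ (sfStep Lc 0) (smStep d Lc 0) (T2RecOf d Lc (fun j => KInvStep (d := d) Lc j) (SpureRecAt d Lc (toSite r) cE cVH cΛ) (M1At d Lc (toSite r) cΛ) cE₂ cB Tc vh₂S (mixFFAt (toSite r) Lc) 0)) κ' κ (Sum.inl κ₁) (Sum.inl κ₂) := by
  rw [T2RecAt_zero_level, T2RecOf_zero_level]

/-- NOT IN PRINT; OUR BOOKKEEPING.  **(C) OF RECORD ⟺ (C)sym** at `d = 3`, `3 ≤ Lc`, the D1 literal's pin `cE₂ = Lc⁸`, generic colour constants `cE cVH cΛ cB`,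
generic `Tc`, any off-diagonal jointly `Lc`-covariant `LocStencil₂` border: the (α-END)'s charge input «(C) of record» (`RelSourceHalfCharge.zsym_relSource_half`'s `hC`,
VERBATIM at `d = 3`) holds at every level IFF route WC-TL's letter (C)sym (`ThreeFaceRecClosed.exists_allScalesSeq_JsRowD1Pin_of_C_QD`'s `hC`, VERBATIM at generic
constants) holds at every level — both say `zmodeSym_Lc (T̃_n) = zmodeSym_Lc (T̃_0)` (§1), the reference tower's charge being that constant (§2, member `0` shared). -/
theorem rowC_iff_CSym_three (hLc : 3 ≤ Lc) {r : Fin (3 + 1) → ℕ} (hr : r ∈ box (3 + 1) Lc) (cE cVH cΛ cE₂ cB : ℝ) (Tc : Fin 4 → Fin 4 → Fin 4 → Fin 4 → ℝ)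
    {vh₂S : Tab 3} (hBff : ∀ κ u κ' u' x z (α β : Fin (3 + 1)), vh₂S κ u κ' u' x z (Sum.inl α) (Sum.inl β) = 0)
    (hBmm : ∀ κ u κ' u' x z (μ ν : Fin (3 + 1)), vh₂S κ u κ' u' x z (Sum.inr μ) (Sum.inr ν) = 0)
    {CB δB : ℝ} (hB : LocStencil₂ vh₂S CB δB) (hδB : 0 < δB)
    (hBt : ∀ (κ : Fin (3 + 1)) (u : Fin (3 + 1) → ℤ) (κ' : Fin (3 + 1)) (u' t : Fin (3 + 1) → ℤ),
      vh₂S κ (u + (Lc : ℤ) • t) κ' (u' + (Lc : ℤ) • t) = shiftK (-((Lc : ℤ) • t)) (vh₂S κ u κ' u'))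
    (hcE₂ : cE₂ = (Lc : ℝ) ^ 8) :
    (∀ (l : ℕ) (κ κ' κ₁ κ₂ : Fin (3 + 1)),
      zmode Lc ((unitS₂ (sfStep Lc (l + 1)) (smStep 3 Lc (l + 1)) (T2RecAt 3 Lc (toSite r) cE cVH cΛ cE₂ cB Tc vh₂S (mixFFAt (toSite r) Lc) (l + 1)))
            - lin4 (cE₂ * (Lc : ℝ) ^ (2 * (3 + 1))) (unitK (sfStep Lc l) (smStep 3 Lc l) (KInvStep (d := 3) Lc l)) Lc
              (unitS₂ (sfStep Lc l) (smStep 3 Lc l) (T2RecAt 3 Lc (toSite r) cE cVH cΛ cE₂ cB Tc vh₂S (mixFFAt (toSite r) Lc) l))) κ κ' (Sum.inl κ₁) (Sum.inl κ₂)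
        + zmode Lc ((unitS₂ (sfStep Lc (l + 1)) (smStep 3 Lc (l + 1)) (T2RecAt 3 Lc (toSite r) cE cVH cΛ cE₂ cB Tc vh₂S (mixFFAt (toSite r) Lc) (l + 1)))
            - lin4 (cE₂ * (Lc : ℝ) ^ (2 * (3 + 1))) (unitK (sfStep Lc l) (smStep 3 Lc l) (KInvStep (d := 3) Lc l)) Lc
              (unitS₂ (sfStep Lc l) (smStep 3 Lc l) (T2RecAt 3 Lc (toSite r) cE cVH cΛ cE₂ cB Tc vh₂S (mixFFAt (toSite r) Lc) l))) κ' κ (Sum.inl κ₁) (Sum.inl κ₂) = 0)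
      ↔ ∀ (i : ℕ) (κ κ' κ₁ κ₂ : Fin (3 + 1)),
        zmode Lc (unitS₂ (sfStep Lc i) (smStep 3 Lc i) (T2RecAt 3 Lc (toSite r) cE cVH cΛ cE₂ cB Tc vh₂S (mixFFAt (toSite r) Lc) i)) κ κ' (Sum.inl κ₁) (Sum.inl κ₂)
        + zmode Lc (unitS₂ (sfStep Lc i) (smStep 3 Lc i) (T2RecAt 3 Lc (toSite r) cE cVH cΛ cE₂ cB Tc vh₂S (mixFFAt (toSite r) Lc) i)) κ' κ (Sum.inl κ₁) (Sum.inl κ₂)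
          = zmode Lc (unitS₂ (sfStep Lc i) (smStep 3 Lc i) (T2RecOf 3 Lc (fun j => KInvStep (d := 3) Lc j) (SpureRecAt 3 Lc (toSite r) cE cVH cΛ) (M1At 3 Lc (toSite r) cΛ) cE₂ cB Tc vh₂S (mixFFAt (toSite r) Lc) i)) κ κ' (Sum.inl κ₁) (Sum.inl κ₂)
        + zmode Lc (unitS₂ (sfStep Lc i) (smStep 3 Lc i) (T2RecOf 3 Lc (fun j => KInvStep (d := 3) Lc j) (SpureRecAt 3 Lc (toSite r) cE cVH cΛ) (M1At 3 Lc (toSite r) cΛ) cE₂ cB Tc vh₂S (mixFFAt (toSite r) Lc) i)) κ' κ (Sum.inl κ₁) (Sum.inl κ₂) := by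
  have hLc1 : 1 ≤ Lc := le_trans (by norm_num) hLc
  have hpin : cE₂ = (Lc : ℝ) ^ (3 + 5) := hcE₂.trans (by norm_num)
  constructor
  · intro hC i κ κ' κ₁ κ₂
    rw [zsymMember_eq_zero_level_of_rowC (d := 3) hLc1 hr cE cVH cΛ cE₂ cB Tc ⟨CB, δB, hδB, hB⟩ hBt hpin hC i κ κ' κ₁ κ₂,
      zsymMemberB_eq_zero_level_three hLc hr cE cVH cΛ cE₂ cB Tc hBff hBmm hB hδB hBt hcE₂ i κ κ' κ₁ κ₂]
    exact zsymMember_zero_eq_zsymMemberB_zero (d := 3) cE cVH cΛ cE₂ cB Tc vh₂S κ κ' κ₁ κ₂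
  · intro hS
    refine rowC_of_zsymMember_eq_zero_level (d := 3) hLc1 hr cE cVH cΛ cE₂ cB Tc ⟨CB, δB, hδB, hB⟩ hBt hpin ?_
    intro n κ κ' κ₁ κ₂
    rw [hS n κ κ' κ₁ κ₂, hS 0 κ κ' κ₁ κ₂]
    exact zsymMemberB_eq_zero_level_three hLc hr cE cVH cΛ cE₂ cB Tc hBff hBmm hB hδB hBt hcE₂ n κ κ' κ₁ κ₂

/-- NOT IN PRINT; OUR BOOKKEEPING.  **THE (α-END)'s DISPLAYED `hC` FOR THE `ε`-MEMBER ⟸ (C)sym** (`d = 3`, `3 ≤ Lc`, pin `cE₂ = Lc⁸`, every `ε`): the binder `hC` of the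
OWNER gan24-p1's `T2ShapeEvenEndRows.locStencil₂_halfMember_three_of_rows` ∕ `T2DriftEvenEndRows.rate_halfMember_three_of_rows` (the `ZfreeSym` antisymmetry of the
`ε`-member's relative source `b^{rel,ε}_l`), at `d = 3` VERBATIM, from route WC-TL's letter (C)sym — §3 ⨾ this lineage's g72 `RelSourceHalfCharge.zsym_relSource_half`. -/
theorem hC_halfMember_of_CSym_three (hLc : 3 ≤ Lc) {r : Fin (3 + 1) → ℕ} (hr : r ∈ box (3 + 1) Lc) (cE cVH cΛ cE₂ cB : ℝ) (Tc : Fin 4 → Fin 4 → Fin 4 → Fin 4 → ℝ)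
    {vh₂S : Tab 3} (hBff : ∀ κ u κ' u' x z (α β : Fin (3 + 1)), vh₂S κ u κ' u' x z (Sum.inl α) (Sum.inl β) = 0)
    (hBmm : ∀ κ u κ' u' x z (μ ν : Fin (3 + 1)), vh₂S κ u κ' u' x z (Sum.inr μ) (Sum.inr ν) = 0)
    {CB δB : ℝ} (hB : LocStencil₂ vh₂S CB δB) (hδB : 0 < δB)
    (hBt : ∀ (κ : Fin (3 + 1)) (u : Fin (3 + 1) → ℤ) (κ' : Fin (3 + 1)) (u' t : Fin (3 + 1) → ℤ),
      vh₂S κ (u + (Lc : ℤ) • t) κ' (u' + (Lc : ℤ) • t) = shiftK (-((Lc : ℤ) • t)) (vh₂S κ u κ' u'))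
    (hcE₂ : cE₂ = (Lc : ℝ) ^ 8) (ε : ℝ)
    (hS : ∀ (i : ℕ) (κ κ' κ₁ κ₂ : Fin (3 + 1)),
      zmode Lc (unitS₂ (sfStep Lc i) (smStep 3 Lc i) (T2RecAt 3 Lc (toSite r) cE cVH cΛ cE₂ cB Tc vh₂S (mixFFAt (toSite r) Lc) i)) κ κ' (Sum.inl κ₁) (Sum.inl κ₂)
        + zmode Lc (unitS₂ (sfStep Lc i) (smStep 3 Lc i) (T2RecAt 3 Lc (toSite r) cE cVH cΛ cE₂ cB Tc vh₂S (mixFFAt (toSite r) Lc) i)) κ' κ (Sum.inl κ₁) (Sum.inl κ₂)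
        = zmode Lc (unitS₂ (sfStep Lc i) (smStep 3 Lc i) (T2RecOf 3 Lc (fun j => KInvStep (d := 3) Lc j) (SpureRecAt 3 Lc (toSite r) cE cVH cΛ) (M1At 3 Lc (toSite r) cΛ) cE₂ cB Tc vh₂S (mixFFAt (toSite r) Lc) i)) κ κ' (Sum.inl κ₁) (Sum.inl κ₂)
        + zmode Lc (unitS₂ (sfStep Lc i) (smStep 3 Lc i) (T2RecOf 3 Lc (fun j => KInvStep (d := 3) Lc j) (SpureRecAt 3 Lc (toSite r) cE cVH cΛ) (M1At 3 Lc (toSite r) cΛ) cE₂ cB Tc vh₂S (mixFFAt (toSite r) Lc) i)) κ' κ (Sum.inl κ₁) (Sum.inl κ₂))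
    (l : ℕ) (κ κ' κ₁ κ₂ : Fin (3 + 1)) :
    zmode Lc (((1 / 2 : ℝ) • ((fun κ u κ' u' => (cE₂ * (Lc : ℝ) ^ (2 * (3 + 1))) • mmRead Lc (K3OfK
            (unitK (sfStep Lc l) (smStep 3 Lc l) (coDressKBmAt (toSite r) Lc (KInvStep (d := 3) Lc l))) Lc
            (unitS (sfStep Lc l) (smStep 3 Lc l) (SpureRecAt 3 Lc (toSite r) cE cVH cΛ l)) (unitM (sfStep Lc l) (smStep 3 Lc l) (M1At 3 Lc (toSite r) cΛ l))
            (W2SymOfK (unitK (sfStep Lc l) (smStep 3 Lc l) (coDressKBmAt (toSite r) Lc (KInvStep (d := 3) Lc l))) Lc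
              (unitS (sfStep Lc l) (smStep 3 Lc l) (SpureRecAt 3 Lc (toSite r) cE cVH cΛ l)) (unitM (sfStep Lc l) (smStep 3 Lc l) (M1At 3 Lc (toSite r) cΛ l)) 0
              (unitM₂ (sfStep Lc l) (smStep 3 Lc l) (M2Of 3 Lc (mixFFAt (toSite r) Lc) l))) κ u κ' u') + cB • vh₂S κ u κ' u')
          + ε • fun κ u κ' u' => sgnK (trK ((fun κ u κ' u' => (cE₂ * (Lc : ℝ) ^ (2 * (3 + 1))) • mmRead Lc (K3OfK
            (unitK (sfStep Lc l) (smStep 3 Lc l) (coDressKBmAt (toSite r) Lc (KInvStep (d := 3) Lc l))) Lc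
            (unitS (sfStep Lc l) (smStep 3 Lc l) (SpureRecAt 3 Lc (toSite r) cE cVH cΛ l)) (unitM (sfStep Lc l) (smStep 3 Lc l) (M1At 3 Lc (toSite r) cΛ l))
            (W2SymOfK (unitK (sfStep Lc l) (smStep 3 Lc l) (coDressKBmAt (toSite r) Lc (KInvStep (d := 3) Lc l))) Lc
              (unitS (sfStep Lc l) (smStep 3 Lc l) (SpureRecAt 3 Lc (toSite r) cE cVH cΛ l)) (unitM (sfStep Lc l) (smStep 3 Lc l) (M1At 3 Lc (toSite r) cΛ l)) 0
              (unitM₂ (sfStep Lc l) (smStep 3 Lc l) (M2Of 3 Lc (mixFFAt (toSite r) Lc) l))) κ u κ' u') + cB • vh₂S κ u κ' u') κ u κ' u'))))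
        + (lin4 (cE₂ * (Lc : ℝ) ^ (2 * (3 + 1))) (unitK (sfStep Lc l) (smStep 3 Lc l) (coDressKBmAt (toSite r) Lc (KInvStep (d := 3) Lc l))) Lc
              ((1 / 2 : ℝ) • (unitS₂ (sfStep Lc l) (smStep 3 Lc l) (T2RecAt 3 Lc (toSite r) cE cVH cΛ cE₂ cB Tc vh₂S (mixFFAt (toSite r) Lc) l)
          + ε • fun κ u κ' u' => sgnK (trK (unitS₂ (sfStep Lc l) (smStep 3 Lc l) (T2RecAt 3 Lc (toSite r) cE cVH cΛ cE₂ cB Tc vh₂S (mixFFAt (toSite r) Lc) l) κ u κ' u'))))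
          - lin4 (cE₂ * (Lc : ℝ) ^ (2 * (3 + 1))) (unitK (sfStep Lc l) (smStep 3 Lc l) (KInvStep (d := 3) Lc l)) Lc
              ((1 / 2 : ℝ) • (unitS₂ (sfStep Lc l) (smStep 3 Lc l) (T2RecAt 3 Lc (toSite r) cE cVH cΛ cE₂ cB Tc vh₂S (mixFFAt (toSite r) Lc) l)
          + ε • fun κ u κ' u' => sgnK (trK (unitS₂ (sfStep Lc l) (smStep 3 Lc l) (T2RecAt 3 Lc (toSite r) cE cVH cΛ cE₂ cB Tc vh₂S (mixFFAt (toSite r) Lc) l) κ u κ' u')))))) κ κ' (Sum.inl κ₁) (Sum.inl κ₂)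
      + zmode Lc (((1 / 2 : ℝ) • ((fun κ u κ' u' => (cE₂ * (Lc : ℝ) ^ (2 * (3 + 1))) • mmRead Lc (K3OfK
            (unitK (sfStep Lc l) (smStep 3 Lc l) (coDressKBmAt (toSite r) Lc (KInvStep (d := 3) Lc l))) Lc
            (unitS (sfStep Lc l) (smStep 3 Lc l) (SpureRecAt 3 Lc (toSite r) cE cVH cΛ l)) (unitM (sfStep Lc l) (smStep 3 Lc l) (M1At 3 Lc (toSite r) cΛ l))
            (W2SymOfK (unitK (sfStep Lc l) (smStep 3 Lc l) (coDressKBmAt (toSite r) Lc (KInvStep (d := 3) Lc l))) Lc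
              (unitS (sfStep Lc l) (smStep 3 Lc l) (SpureRecAt 3 Lc (toSite r) cE cVH cΛ l)) (unitM (sfStep Lc l) (smStep 3 Lc l) (M1At 3 Lc (toSite r) cΛ l)) 0
              (unitM₂ (sfStep Lc l) (smStep 3 Lc l) (M2Of 3 Lc (mixFFAt (toSite r) Lc) l))) κ u κ' u') + cB • vh₂S κ u κ' u')
          + ε • fun κ u κ' u' => sgnK (trK ((fun κ u κ' u' => (cE₂ * (Lc : ℝ) ^ (2 * (3 + 1))) • mmRead Lc (K3OfK
            (unitK (sfStep Lc l) (smStep 3 Lc l) (coDressKBmAt (toSite r) Lc (KInvStep (d := 3) Lc l))) Lc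
            (unitS (sfStep Lc l) (smStep 3 Lc l) (SpureRecAt 3 Lc (toSite r) cE cVH cΛ l)) (unitM (sfStep Lc l) (smStep 3 Lc l) (M1At 3 Lc (toSite r) cΛ l))
            (W2SymOfK (unitK (sfStep Lc l) (smStep 3 Lc l) (coDressKBmAt (toSite r) Lc (KInvStep (d := 3) Lc l))) Lc
              (unitS (sfStep Lc l) (smStep 3 Lc l) (SpureRecAt 3 Lc (toSite r) cE cVH cΛ l)) (unitM (sfStep Lc l) (smStep 3 Lc l) (M1At 3 Lc (toSite r) cΛ l)) 0
              (unitM₂ (sfStep Lc l) (smStep 3 Lc l) (M2Of 3 Lc (mixFFAt (toSite r) Lc) l))) κ u κ' u') + cB • vh₂S κ u κ' u') κ u κ' u'))))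
        + (lin4 (cE₂ * (Lc : ℝ) ^ (2 * (3 + 1))) (unitK (sfStep Lc l) (smStep 3 Lc l) (coDressKBmAt (toSite r) Lc (KInvStep (d := 3) Lc l))) Lc
              ((1 / 2 : ℝ) • (unitS₂ (sfStep Lc l) (smStep 3 Lc l) (T2RecAt 3 Lc (toSite r) cE cVH cΛ cE₂ cB Tc vh₂S (mixFFAt (toSite r) Lc) l)
          + ε • fun κ u κ' u' => sgnK (trK (unitS₂ (sfStep Lc l) (smStep 3 Lc l) (T2RecAt 3 Lc (toSite r) cE cVH cΛ cE₂ cB Tc vh₂S (mixFFAt (toSite r) Lc) l) κ u κ' u'))))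
          - lin4 (cE₂ * (Lc : ℝ) ^ (2 * (3 + 1))) (unitK (sfStep Lc l) (smStep 3 Lc l) (KInvStep (d := 3) Lc l)) Lc
              ((1 / 2 : ℝ) • (unitS₂ (sfStep Lc l) (smStep 3 Lc l) (T2RecAt 3 Lc (toSite r) cE cVH cΛ cE₂ cB Tc vh₂S (mixFFAt (toSite r) Lc) l)
          + ε • fun κ u κ' u' => sgnK (trK (unitS₂ (sfStep Lc l) (smStep 3 Lc l) (T2RecAt 3 Lc (toSite r) cE cVH cΛ cE₂ cB Tc vh₂S (mixFFAt (toSite r) Lc) l) κ u κ' u')))))) κ' κ (Sum.inl κ₁) (Sum.inl κ₂) = 0 :=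
  zsym_relSource_half (d := 3) (le_trans (by norm_num) hLc) hr cE cVH cΛ cE₂ cB Tc hBff hBmm ⟨CB, δB, hδB, hB⟩ ε
    ((rowC_iff_CSym_three hLc hr cE cVH cΛ cE₂ cB Tc hBff hBmm hB hδB hBt hcE₂).2 hS) l κ κ' κ₁ κ₂

end Summit.QuantumFields.BalabanUV.Beta.GAN24.RowCChargeForms

end
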